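import Summits.HubbardSuperconductivity.HubbardSuperconductivity.Theorems.BalabanIRBirBdGPhaseCoercivityNambu
import Summits.HubbardSuperconductivity.HubbardSuperconductivity.Theorems.BalabanIRBirBdGPhaseCoercivityModes
import Summits.HubbardSuperconductivity.HubbardSuperconductivity.Theses.BalabanIR

/-!
# Route BalabanIR — crux 3 `BirBdGPhaseCoercivity` (item `stmt-HubbardSuperconductivity-2081`):
# VII. The frozen-Nambu-metric reduction: phase coercivity from the one-loop symbol inequality

Assembly of files I–VI. THEOREM (`coercive_of_symbolIneq`): fix `μ ∈ (-4,4)`, `Δ₁Δ₂ ≠ 0`,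
`L ≥ 3`, and let `ξ_k = -2cos p₀ - 2cos p₁ - μ`, `Δ_k = 2Δ₁(cos p₀ - cos p₁) - 4iΔ₂ sin p₀ sin p₁`,
`E_k = √(ξ_k² + |Δ_k|²)` (`p = 2πk/L`). If the ONE-LOOP SYMBOL INEQUALITY
  `(★)  2 c₀ L² ε(q) ≤ G_L(q) := Σ_k [2|Δ_k|²/E_k - (|Δ_k + Δ_{k+q}|² + |Δ_k + Δ_{k-q}|²)/(4E_k)]`,
  `ε(q) = 4 - 2cos q₀ - 2cos q₁`,
holds for every texture momentum `q ≠ 0` of `(ℤ/L)²`, then the conclusion of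
`BirBdGPhaseCoercivity` holds at `(μ, Δ₁, Δ₂)` on the torus of side `L` with the SAME constant:
`c₀ Σ_x Σ_{y∼x} (1 - cos(θ_x - θ_y)) ≤ Σ_i|λ_i(Hb(0))| - Σ_i|λ_i(Hb(θ))|` for every `θ`.
(`G_L(q) = Σ_k K(k,k+q)` with the kernel `K` of the crux idea `frozen-nambu-metric`, by the
reindexing `k ↦ k - q` in its last term.) COROLLARY (`birBdGPhaseCoercivity_of_symbolIneq`): (★)
for all parameters, eventually in `L`, implies the crux.

PROOF. `S(0) - S(θ) ≥ ½ Re Tr (M⁻¹(Hb(0)² - Hb(θ)²))` for the frozen metric `M = |Hb(0)|`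
(file I; `M = L⁻² W₂ᴴ (E ⊕ E) W₂` is checked to be `|Hb(0)|` in file V using the symbols of
files III–IV); the right-hand side is `½ L⁻⁴ Σ_q |û(q)|² G_L(q)` (files V–VI, `û` = Fourier
amplitudes of `e^{iθ}`, `Σ_q |û(q)|² = L⁴`), while the XY functional is `L⁻² Σ_q |û(q)|² ε(q)`
(file VI); (★) compares them mode by mode (`q = 0` contributes `0 = 0`).

HONEST SCOPE (for the planner; numerics of the crux-ideate round, kit j004996): (★) is certified
numerically on a central band in `μ` whose width grows with the gap (e.g. `c_tan = +0.0331` at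
`(μ,Δ₁,Δ₂) = (-1, 0.3, 0.1)`, argmin `q = (π,π)`), and FAILS near the band edges at moderate gaps
(`|μ| ≥ 3.5` at `(0.3, 0.1)`, argmin `q = (π,0)`): this reduction settles the crux wherever (★) is
proved, not on all of `(-4,4)`. No definition is introduced.
-/

noncomputable section

namespace Summit.HubbardSuperconductivity.HubbardSuperconductivity.Theorems

namespace BirBdG

open Matrix Finset Literature.Probability.LatticeModels
open scoped ComplexConjugate ComplexOrder

variable {L : ℕ} [NeZero L]

/-- **Frozen-Nambu-metric reduction of the phase-coercivity crux** (crux ideas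
`frozen-nambu-metric`, `sqrt-concavity-multiplier`): at fixed `(μ, Δ₁, Δ₂)` with `μ ∈ (-4,4)`,
`Δ₁Δ₂ ≠ 0`, on the torus `(ℤ/L)²`, `L ≥ 3`, the one-loop symbol inequality (★) for all `q ≠ 0`
implies the conclusion of `BirBdGPhaseCoercivity` at side `L` with the same constant `c₀`. The
symbols are passed as functions `ξ, Δ, E` pinned by `hξ, hΔ, hE`. [folklore] -/
theorem coercive_of_symbolIneq (μ Δ₁ Δ₂ c₀ : ℝ) (hL : 3 ≤ L) (hμ : μ ∈ Set.Ioo (-4 : ℝ) 4)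
    (h₁ : Δ₁ ≠ 0) (h₂ : Δ₂ ≠ 0) (ξ E : TorusSite 2 L → ℝ) (Δ : TorusSite 2 L → ℂ)
    (hξ : ∀ k, ξ k = -2 * Real.cos (latticeMomentum L k 0) - 2 * Real.cos (latticeMomentum L k 1) - μ)
    (hΔ : ∀ k, Δ k = ((2 * Δ₁ * (Real.cos (latticeMomentum L k 0) - Real.cos (latticeMomentum L k 1)) : ℝ) : ℂ) -
        4 * Complex.I * ((Δ₂ * Real.sin (latticeMomentum L k 0) * Real.sin (latticeMomentum L k 1) : ℝ) : ℂ))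
    (hE : ∀ k, E k = Real.sqrt (ξ k ^ 2 + ‖Δ k‖ ^ 2))
    (hsym : ∀ q : TorusSite 2 L, q ≠ 0 →
      2 * c₀ * ((L ^ 2 : ℕ) : ℝ) *
          (4 - 2 * Real.cos (latticeMomentum L q 0) - 2 * Real.cos (latticeMomentum L q 1)) ≤
        ∑ k, (2 * ‖Δ k‖ ^ 2 / E k -
          (‖Δ k + Δ (k + q)‖ ^ 2 + ‖Δ k + Δ (k - q)‖ ^ 2) / (4 * E k))) :
    let nnx : Literature.Probability.LatticeModels.TorusSite 2 L → Literature.Probability.LatticeModels.TorusSite 2 L → Prop := fun x y => y = x + ![1, 0] ∨ y = x + ![-1, 0]; let nny : Literature.Probability.LatticeModels.TorusSite 2 L → Literature.Probability.LatticeModels.TorusSite 2 L → Prop := fun x y => y = x + ![0, 1] ∨ y = x + ![0, -1]; let dg1 : Literature.Probability.LatticeModels.TorusSite 2 L → Literature.Probability.LatticeModels.TorusSite 2 L → Prop := fun x y => y = x + ![1, 1] ∨ y = x + ![-1, -1]; let dg2 : Literature.Probability.LatticeModels.TorusSite 2 L → Literature.Probability.LatticeModels.TorusSite 2 L → Prop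 := fun x y => y = x + ![1, -1] ∨ y = x + ![-1, 1]; let h : Matrix (Literature.Probability.LatticeModels.TorusSite 2 L) (Literature.Probability.LatticeModels.TorusSite 2 L) ℂ := fun x y => -(if nnx x y ∨ nny x y then (1 : ℂ) else 0) - (if x = y then (μ : ℂ) else 0); let D : (Literature.Probability.LatticeModels.TorusSite 2 L → ℝ) → Matrix (Literature.Probability.LatticeModels.TorusSite 2 L) (Literature.Probability.LatticeModels.TorusSite 2 L) ℂ := fun θ x y => ((Δ₁ : ℂ) * ((if nnx x y then (1 : ℂ) else 0) - (if nny x y then (1 : ℂ) else 0)) + Complex.I * (Δ₂ : ℂ) * ((if dg1 x y then (1 : ℂ) else 0) - (if dg2 x y then (1 : ℂ) else 0))) * (Complex.exp (Complex.I * (θ x : ℂ)) + Complex.exp (Complex.I * (θ y : ℂ))) / 2; let Hb : (Literature.Probability.LatticeModels.TorusSite 2 L → ℝ) → Matrix (Literature.Probability.LatticeModels.TorusSite 2 L ⊕ Literature.Probability.LatticeModels.TorusSite 2 L) (Literature.Probability.LatticeModels.TorusSite 2 L ⊕ Literature.Probability.LatticeModels.TorusSite 2 L) ℂ := fun θ =>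 Matrix.fromBlocks h (D θ) (Matrix.conjTranspose (D θ)) (-h); ∀ θ : Literature.Probability.LatticeModels.TorusSite 2 L → ℝ, ∀ (hθ : (Hb θ).IsHermitian) (h0 : (Hb (fun _ => 0)).IsHermitian), c₀ * ∑ x : Literature.Probability.LatticeModels.TorusSite 2 L, ∑ y : Literature.Probability.LatticeModels.TorusSite 2 L, (if nnx x y ∨ nny x y then (1 - Real.cos (θ x - θ y)) else 0) ≤ ∑ i, |h0.eigenvalues i| - ∑ i, |hθ.eigenvalues i| := by
  intro nnx nny dg1 dg2 h D Hb θ hθ h0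
  -- the scaled plane-wave unitary `W` (written out) and `N = L²`
  have hN : (L ^ 2 : ℕ) ≠ 0 := pow_ne_zero 2 (NeZero.ne L)
  have hNr : ((L ^ 2 : ℕ) : ℝ) ≠ 0 := by exact_mod_cast hN
  have h1 := planeWave_conjTranspose_mul_self (d := 2) (L := L)
  have h2 := planeWave_mul_conjTranspose_self (d := 2) (L := L)
  -- stencils and the texture
  set a : TorusSite 2 L → ℂ := fun r : TorusSite 2 L =>
    -(if ((r = -![1, 0] ∨ r = -![-1, 0]) ∨ (r = -![0, 1] ∨ r = -![0, -1])) then (1 : ℂ) else 0) -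
      (if r = 0 then (μ : ℂ) else 0) with ha
  set dv : TorusSite 2 L → ℂ := fun r : TorusSite 2 L =>
    (Δ₁ : ℂ) * ((if (r = -![1, 0] ∨ r = -![-1, 0]) then (1 : ℂ) else 0) -
      (if (r = -![0, 1] ∨ r = -![0, -1]) then (1 : ℂ) else 0)) +
    Complex.I * (Δ₂ : ℂ) * ((if (r = -![1, 1] ∨ r = -![-1, -1]) then (1 : ℂ) else 0) -
      (if (r = -![1, -1] ∨ r = -![-1, 1]) then (1 : ℂ) else 0)) with hdv
  set u : TorusSite 2 L → ℂ := fun x => Complex.exp (Complex.I * (θ x : ℂ)) with hu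
  -- the gap is open
  have hdisp : ∀ k, 0 < ξ k ^ 2 + ‖Δ k‖ ^ 2 := by
    intro k
    rw [hξ, hΔ]
    exact bdg_dispersion_pos μ Δ₁ Δ₂ _ _ hμ h₁ h₂
  have hEpos : ∀ k, 0 < E k := fun k => by rw [hE]; exact Real.sqrt_pos.2 (hdisp k)
  have hEsq : ∀ k, E k ^ 2 = ξ k ^ 2 + ‖Δ k‖ ^ 2 := fun k => by
    rw [hE, Real.sq_sqrt (hdisp k).le]
  -- symbols
  have hFa : torusFourier a = fun k => (ξ k : ℂ) := by
    funext k
    rw [ha, torusFourier_hopVec hL μ k, hξ]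
  have hFd : torusFourier dv = Δ := by
    funext k
    rw [hdv, torusFourier_pairVec hL Δ₁ Δ₂ k, hΔ]
  -- the crux's matrices in structured form
  have hh : h = Matrix.circulant a := hopping_eq_circulant μ
  have hDθ : D θ = (1 / 2 : ℂ) • (Matrix.diagonal u * Matrix.circulant dv +
      Matrix.circulant dv * Matrix.diagonal u) := pairing_eq_anticommutator Δ₁ Δ₂ θ
  have hD0 : D (fun _ => 0) = Matrix.circulant dv := by
    have key := pairing_eq_anticommutator (L := L) Δ₁ Δ₂ (fun _ => (0 : ℝ))
    rw [← hdv] at key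
    change D (fun _ => 0) = _ at key
    rw [key]
    have hu0 : (Matrix.diagonal fun _ : TorusSite 2 L => Complex.exp (Complex.I * ((0 : ℝ) : ℂ))) = 1 := by
      rw [Complex.ofReal_zero, mul_zero, Complex.exp_zero]; exact Matrix.diagonal_one
    rw [hu0, Matrix.one_mul, Matrix.mul_one, ← two_smul ℂ (Matrix.circulant dv), smul_smul,
      show (1 / 2 : ℂ) * 2 = 1 by norm_num, one_smul]
  -- plane-wave (hat) forms of the blocks
  have hath : ((L ^ 2 : ℕ) : ℂ)⁻¹ • (Matrix.of (fun k x : TorusSite 2 L => conj (torusChar k x)) * h *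
      (Matrix.of fun k x : TorusSite 2 L => conj (torusChar k x))ᴴ) = Matrix.diagonal (fun k => (ξ k : ℂ)) := by
    rw [hh, hat_circulant, hFa]
  have hatC : ((L ^ 2 : ℕ) : ℂ)⁻¹ • (Matrix.of (fun k x : TorusSite 2 L => conj (torusChar k x)) *
      Matrix.circulant dv * (Matrix.of fun k x : TorusSite 2 L => conj (torusChar k x))ᴴ) =
      Matrix.diagonal Δ := by
    rw [hat_circulant, hFd]
  have hatCh : ((L ^ 2 : ℕ) : ℂ)⁻¹ • (Matrix.of (fun k x : TorusSite 2 L => conj (torusChar k x)) *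
      (Matrix.circulant dv)ᴴ * (Matrix.of fun k x : TorusSite 2 L => conj (torusChar k x))ᴴ) =
      (Matrix.diagonal Δ)ᴴ := by
    rw [hat_conjTranspose, hatC]
  have hatnegh : ((L ^ 2 : ℕ) : ℂ)⁻¹ • (Matrix.of (fun k x : TorusSite 2 L => conj (torusChar k x)) * (-h) *
      (Matrix.of fun k x : TorusSite 2 L => conj (torusChar k x))ᴴ) = -Matrix.diagonal (fun k => (ξ k : ℂ)) := by
    rw [Matrix.mul_neg, Matrix.neg_mul, smul_neg, hath]
  set Dh : Matrix (TorusSite 2 L) (TorusSite 2 L) ℂ := ((L ^ 2 : ℕ) : ℂ)⁻¹ •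
    (Matrix.of (fun k x : TorusSite 2 L => conj (torusChar k x)) * D θ *
      (Matrix.of fun k x : TorusSite 2 L => conj (torusChar k x))ᴴ) with hDhdef
  have hatDθh : ((L ^ 2 : ℕ) : ℂ)⁻¹ • (Matrix.of (fun k x : TorusSite 2 L => conj (torusChar k x)) *
      (D θ)ᴴ * (Matrix.of fun k x : TorusSite 2 L => conj (torusChar k x))ᴴ) = Dhᴴ :=
    hat_conjTranspose (D θ)
  have hX₀ : ((L ^ 2 : ℕ) : ℂ)⁻¹ • (Matrix.fromBlocks (Matrix.of (fun k x : TorusSite 2 L => conj (torusChar k x))) 0 0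
        (Matrix.of (fun k x : TorusSite 2 L => conj (torusChar k x))) * Hb (fun _ => 0) *
      (Matrix.fromBlocks (Matrix.of (fun k x : TorusSite 2 L => conj (torusChar k x))) 0 0
        (Matrix.of (fun k x : TorusSite 2 L => conj (torusChar k x))))ᴴ) =
      Matrix.fromBlocks (Matrix.diagonal fun k => (ξ k : ℂ)) (Matrix.diagonal Δ) (Matrix.diagonal Δ)ᴴ
        (-Matrix.diagonal fun k => (ξ k : ℂ)) := by
    change ((L ^ 2 : ℕ) : ℂ)⁻¹ • (Matrix.fromBlocks (Matrix.of (fun k x : TorusSite 2 L => conj (torusChar k x))) 0 0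
        (Matrix.of (fun k x : TorusSite 2 L => conj (torusChar k x))) *
        Matrix.fromBlocks h (D (fun _ => 0)) (D (fun _ => 0))ᴴ (-h) *
      (Matrix.fromBlocks (Matrix.of (fun k x : TorusSite 2 L => conj (torusChar k x))) 0 0
        (Matrix.of (fun k x : TorusSite 2 L => conj (torusChar k x))))ᴴ) = _
    rw [hat_fromBlocks, hD0, hath, hatC, hatCh, hatnegh]
  have hX : ((L ^ 2 : ℕ) : ℂ)⁻¹ • (Matrix.fromBlocks (Matrix.of (fun k x : TorusSite 2 L => conj (torusChar k x))) 0 0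
        (Matrix.of (fun k x : TorusSite 2 L => conj (torusChar k x))) * Hb θ *
      (Matrix.fromBlocks (Matrix.of (fun k x : TorusSite 2 L => conj (torusChar k x))) 0 0
        (Matrix.of (fun k x : TorusSite 2 L => conj (torusChar k x))))ᴴ) =
      Matrix.fromBlocks (Matrix.diagonal fun k => (ξ k : ℂ)) Dh Dhᴴ (-Matrix.diagonal fun k => (ξ k : ℂ)) := by
    change ((L ^ 2 : ℕ) : ℂ)⁻¹ • (Matrix.fromBlocks (Matrix.of (fun k x : TorusSite 2 L => conj (torusChar k x))) 0 0
        (Matrix.of (fun k x : TorusSite 2 L => conj (torusChar k x))) *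
        Matrix.fromBlocks h (D θ) (D θ)ᴴ (-h) *
      (Matrix.fromBlocks (Matrix.of (fun k x : TorusSite 2 L => conj (torusChar k x))) 0 0
        (Matrix.of (fun k x : TorusSite 2 L => conj (torusChar k x))))ᴴ) = _
    rw [hat_fromBlocks, hath, hatDθh, hatnegh]
  -- the deficit bound of file I with the frozen metric of file V
  have hM := frozenMetric_posDef hN h1 E hEpos
  obtain ⟨hcomm, hsq⟩ := frozenMetric_comm_and_sq hN h1 h2 ξ E Δ hEsq (Hb fun _ => 0) hX₀
  have hdef := half_re_trace_metric_deficit_le (Hb fun _ => 0) (Hb θ) _ h0 hθ hM hcomm hsq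
  rw [frozenMetric_re_trace hN h1 h2 ξ E Δ hEsq hEpos (Hb fun _ => 0) (Hb θ) Dh hX₀ hX] at hdef
  -- the pairing block mode by mode
  have hDh : ∀ k k', Dh k k' = (1 / 2 : ℂ) * (((((L ^ 2 : ℕ) : ℝ) : ℂ))⁻¹ *
      (∑ x, u x * torusChar (k' - k) x)) * (Δ k + Δ k') := by
    intro k k'
    rw [hDhdef, hDθ, hat_pairing_apply u dv k k', hFd]
    push_cast
    ring
  have hmodes := sum_pairingHat_normSq_eq_modes (((L ^ 2 : ℕ) : ℝ)) (fun q => ∑ x, u x * torusChar q x)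
    Δ E Dh hDh
  have hunit : ∀ x, ‖u x‖ = 1 := by
    intro x
    rw [hu]
    dsimp only
    rw [mul_comm, Complex.norm_exp_ofReal_mul_I]
  have hP : ∑ q, ‖∑ x, u x * torusChar q x‖ ^ 2 = ((L ^ 2 : ℕ) : ℝ) * ((L ^ 2 : ℕ) : ℝ) :=
    sum_norm_sq_modes_of_unimodular u hunit
  -- the XY functional mode by mode
  have hR : ∑ x : TorusSite 2 L, ∑ y : TorusSite 2 L,
      (if nnx x y ∨ nny x y then (1 - Real.cos (θ x - θ y)) else 0) =
      ((L ^ 2 : ℕ) : ℝ)⁻¹ * ∑ q, ‖∑ x, u x * torusChar q x‖ ^ 2 *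
        (4 - 2 * Real.cos (latticeMomentum L q 0) - 2 * Real.cos (latticeMomentum L q 1)) :=
    xyFunctional_eq_modes hL θ
  -- mode-by-mode comparison, `q = 0` included
  have hmode : ∀ q : TorusSite 2 L,
      2 * c₀ * ((L ^ 2 : ℕ) : ℝ) *
          (4 - 2 * Real.cos (latticeMomentum L q 0) - 2 * Real.cos (latticeMomentum L q 1)) ≤
        ∑ k, (2 * ‖Δ k‖ ^ 2 / E k -
          (‖Δ k + Δ (k + q)‖ ^ 2 + ‖Δ k + Δ (k - q)‖ ^ 2) / (4 * E k)) := by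
    intro q
    by_cases hq : q = 0
    · subst hq
      have hp : ∀ i, latticeMomentum L (0 : TorusSite 2 L) i = 0 := fun i => by
        simp [latticeMomentum]
      rw [hp 0, hp 1, Real.cos_zero]
      have : ∀ k, 2 * ‖Δ k‖ ^ 2 / E k -
          (‖Δ k + Δ (k + 0)‖ ^ 2 + ‖Δ k + Δ (k - 0)‖ ^ 2) / (4 * E k) = 0 := by
        intro k
        have h2Δ : Δ k + Δ k = 2 * Δ k := by ring
        rw [add_zero, sub_zero, h2Δ, norm_mul, Complex.norm_two]
        ring
      simp only [this, Finset.sum_const_zero]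
      norm_num
    · exact hsym q hq
  -- per-mode form of the symbol: `G(q) = 2A - ¼ G₂(q)`
  have hsplit : ∀ q : TorusSite 2 L, ∑ k, (2 * ‖Δ k‖ ^ 2 / E k -
      (‖Δ k + Δ (k + q)‖ ^ 2 + ‖Δ k + Δ (k - q)‖ ^ 2) / (4 * E k)) =
      2 * ∑ k, ‖Δ k‖ ^ 2 / E k -
        (1 / 4) * ∑ k, (‖Δ k + Δ (k + q)‖ ^ 2 + ‖Δ k + Δ (k - q)‖ ^ 2) / E k := by
    intro q
    rw [Finset.sum_sub_distrib, Finset.mul_sum, Finset.mul_sum]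
    congr 1
    · exact Finset.sum_congr rfl fun k _ => by ring
    · refine Finset.sum_congr rfl fun k _ => ?_
      rw [div_mul_eq_div_div_swap]
      ring
  rw [hR]
  rw [hmodes] at hdef
  refine le_trans ?_ hdef
  -- spread the constant term `2A` over the modes (`Σ_q w_q = N²`)
  have hA : 2 * ∑ k, ‖Δ k‖ ^ 2 / E k =
      ((L ^ 2 : ℕ) : ℝ)⁻¹ ^ 2 * ∑ q, ‖∑ x, u x * torusChar q x‖ ^ 2 * (2 * ∑ k, ‖Δ k‖ ^ 2 / E k) := by
    rw [← Finset.sum_mul, hP]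
    field_simp
  rw [hA]
  -- sum the mode inequalities with the weights `w_q = |û(q)|² ≥ 0`
  have hsum : 2 * c₀ * ((L ^ 2 : ℕ) : ℝ) * ∑ q, ‖∑ x, u x * torusChar q x‖ ^ 2 *
        (4 - 2 * Real.cos (latticeMomentum L q 0) - 2 * Real.cos (latticeMomentum L q 1)) ≤
      ∑ q, ‖∑ x, u x * torusChar q x‖ ^ 2 * (2 * ∑ k, ‖Δ k‖ ^ 2 / E k) -
        1 / 4 * ∑ q, ‖∑ x, u x * torusChar q x‖ ^ 2 *
          ∑ k, (‖Δ k + Δ (k + q)‖ ^ 2 + ‖Δ k + Δ (k - q)‖ ^ 2) / E k := by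
    have hw := Finset.sum_le_sum fun q (_ : q ∈ Finset.univ) =>
      mul_le_mul_of_nonneg_left ((hsplit q) ▸ hmode q) (sq_nonneg ‖∑ x, u x * torusChar q x‖)
    calc 2 * c₀ * ((L ^ 2 : ℕ) : ℝ) * ∑ q, ‖∑ x, u x * torusChar q x‖ ^ 2 *
          (4 - 2 * Real.cos (latticeMomentum L q 0) - 2 * Real.cos (latticeMomentum L q 1))
        = ∑ q, ‖∑ x, u x * torusChar q x‖ ^ 2 * (2 * c₀ * ((L ^ 2 : ℕ) : ℝ) *
            (4 - 2 * Real.cos (latticeMomentum L q 0) - 2 * Real.cos (latticeMomentum L q 1))) := by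
          rw [Finset.mul_sum]
          exact Finset.sum_congr rfl fun q _ => by ring
      _ ≤ ∑ q, ‖∑ x, u x * torusChar q x‖ ^ 2 * (2 * ∑ k, ‖Δ k‖ ^ 2 / E k -
            1 / 4 * ∑ k, (‖Δ k + Δ (k + q)‖ ^ 2 + ‖Δ k + Δ (k - q)‖ ^ 2) / E k) := hw
      _ = ∑ q, ‖∑ x, u x * torusChar q x‖ ^ 2 * (2 * ∑ k, ‖Δ k‖ ^ 2 / E k) -
            1 / 4 * ∑ q, ‖∑ x, u x * torusChar q x‖ ^ 2 *
              ∑ k, (‖Δ k + Δ (k + q)‖ ^ 2 + ‖Δ k + Δ (k - q)‖ ^ 2) / E k := by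
          rw [Finset.mul_sum Finset.univ (fun q => ‖∑ x, u x * torusChar q x‖ ^ 2 *
              ∑ k, (‖Δ k + Δ (k + q)‖ ^ 2 + ‖Δ k + Δ (k - q)‖ ^ 2) / E k) (1 / 4 : ℝ),
            ← Finset.sum_sub_distrib]
          exact Finset.sum_congr rfl fun q _ => by ring
  -- rescale by `N⁻²/2`
  have e4 : c₀ * (((L ^ 2 : ℕ) : ℝ)⁻¹ * ∑ q, ‖∑ x, u x * torusChar q x‖ ^ 2 *
        (4 - 2 * Real.cos (latticeMomentum L q 0) - 2 * Real.cos (latticeMomentum L q 1))) =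
      ((L ^ 2 : ℕ) : ℝ)⁻¹ ^ 2 / 2 * (2 * c₀ * ((L ^ 2 : ℕ) : ℝ) * ∑ q, ‖∑ x, u x * torusChar q x‖ ^ 2 *
        (4 - 2 * Real.cos (latticeMomentum L q 0) - 2 * Real.cos (latticeMomentum L q 1))) := by
    field_simp
  have e5 : (((L ^ 2 : ℕ) : ℝ)⁻¹ ^ 2 * ∑ q, ‖∑ x, u x * torusChar q x‖ ^ 2 * (2 * ∑ k, ‖Δ k‖ ^ 2 / E k) -
      1 / 4 * ((L ^ 2 : ℕ) : ℝ)⁻¹ ^ 2 * ∑ q, ‖∑ x, u x * torusChar q x‖ ^ 2 *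
        ∑ k, (‖Δ k + Δ (k + q)‖ ^ 2 + ‖Δ k + Δ (k - q)‖ ^ 2) / E k) / 2 =
      ((L ^ 2 : ℕ) : ℝ)⁻¹ ^ 2 / 2 * (∑ q, ‖∑ x, u x * torusChar q x‖ ^ 2 * (2 * ∑ k, ‖Δ k‖ ^ 2 / E k) -
        1 / 4 * ∑ q, ‖∑ x, u x * torusChar q x‖ ^ 2 *
          ∑ k, (‖Δ k + Δ (k + q)‖ ^ 2 + ‖Δ k + Δ (k - q)‖ ^ 2) / E k) := by
    ring
  rw [e4, e5]
  exact mul_le_mul_of_nonneg_left hsum (by positivity)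

/-- **The crux from the one-loop symbol inequality.** If for every `μ ∈ (-4,4)` and
`Δ₁, Δ₂ ≠ 0` there are `c₀ > 0` and `L₀` such that (★) holds for all `L ≥ L₀` and all texture
momenta `q ≠ 0` of `(ℤ/L)²`, then `BirBdGPhaseCoercivity` holds (with the same constants, from
side `max L₀ 3` on). This is the transfer lemma `C⁺ ⇒ crux` of the crux ideas
`frozen-nambu-metric` / `sqrt-concavity-multiplier`. [folklore] -/
theorem birBdGPhaseCoercivity_of_symbolIneq
    (H : ∀ (μ Δ₁ Δ₂ : ℝ), μ ∈ Set.Ioo (-4 : ℝ) 4 → Δ₁ ≠ 0 → Δ₂ ≠ 0 →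
      ∃ c₀ : ℝ, 0 < c₀ ∧ ∃ L₀ : ℕ, ∀ (L : ℕ) [NeZero L], L₀ ≤ L →
        ∀ q : TorusSite 2 L, q ≠ 0 →
          2 * c₀ * ((L ^ 2 : ℕ) : ℝ) *
              (4 - 2 * Real.cos (latticeMomentum L q 0) - 2 * Real.cos (latticeMomentum L q 1)) ≤
            ∑ k : TorusSite 2 L,
              (2 * ‖((2 * Δ₁ * (Real.cos (latticeMomentum L k 0) - Real.cos (latticeMomentum L k 1)) : ℝ) : ℂ) -
                    4 * Complex.I * ((Δ₂ * Real.sin (latticeMomentum L k 0) * Real.sin (latticeMomentum L k 1) : ℝ) : ℂ)‖ ^ 2 /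
                  Real.sqrt ((-2 * Real.cos (latticeMomentum L k 0) - 2 * Real.cos (latticeMomentum L k 1) - μ) ^ 2 +
                    ‖((2 * Δ₁ * (Real.cos (latticeMomentum L k 0) - Real.cos (latticeMomentum L k 1)) : ℝ) : ℂ) -
                      4 * Complex.I * ((Δ₂ * Real.sin (latticeMomentum L k 0) * Real.sin (latticeMomentum L k 1) : ℝ) : ℂ)‖ ^ 2) -
                (‖(((2 * Δ₁ * (Real.cos (latticeMomentum L k 0) - Real.cos (latticeMomentum L k 1)) : ℝ) : ℂ) -
                      4 * Complex.I * ((Δ₂ * Real.sin (latticeMomentum L k 0) * Real.sin (latticeMomentum L k 1) : ℝ) : ℂ)) +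
                    (((2 * Δ₁ * (Real.cos (latticeMomentum L (k + q) 0) - Real.cos (latticeMomentum L (k + q) 1)) : ℝ) : ℂ) -
                      4 * Complex.I * ((Δ₂ * Real.sin (latticeMomentum L (k + q) 0) * Real.sin (latticeMomentum L (k + q) 1) : ℝ) : ℂ))‖ ^ 2 +
                  ‖(((2 * Δ₁ * (Real.cos (latticeMomentum L k 0) - Real.cos (latticeMomentum L k 1)) : ℝ) : ℂ) -
                      4 * Complex.I * ((Δ₂ * Real.sin (latticeMomentum L k 0) * Real.sin (latticeMomentum L k 1) : ℝ) : ℂ)) +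
                    (((2 * Δ₁ * (Real.cos (latticeMomentum L (k - q) 0) - Real.cos (latticeMomentum L (k - q) 1)) : ℝ) : ℂ) -
                      4 * Complex.I * ((Δ₂ * Real.sin (latticeMomentum L (k - q) 0) * Real.sin (latticeMomentum L (k - q) 1) : ℝ) : ℂ))‖ ^ 2) /
                  (4 * Real.sqrt ((-2 * Real.cos (latticeMomentum L k 0) - 2 * Real.cos (latticeMomentum L k 1) - μ) ^ 2 +
                    ‖((2 * Δ₁ * (Real.cos (latticeMomentum L k 0) - Real.cos (latticeMomentum L k 1)) : ℝ) : ℂ) -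
                      4 * Complex.I * ((Δ₂ * Real.sin (latticeMomentum L k 0) * Real.sin (latticeMomentum L k 1) : ℝ) : ℂ)‖ ^ 2)))) :
    Summit.HubbardSuperconductivity.HubbardSuperconductivity.Theses.BalabanIR.BirBdGPhaseCoercivity := by
  intro μ Δ₁ Δ₂ hμ h₁ h₂
  obtain ⟨c₀, hc₀, L₀, hL₀⟩ := H μ Δ₁ Δ₂ hμ h₁ h₂
  refine ⟨c₀, hc₀, max L₀ 3, ?_⟩
  intro L _ hL
  have hL3 : 3 ≤ L := le_trans (le_max_right _ _) hL
  have hLL : L₀ ≤ L := le_trans (le_max_left _ _) hL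
  exact coercive_of_symbolIneq μ Δ₁ Δ₂ c₀ hL3 hμ h₁ h₂
    (fun k => -2 * Real.cos (latticeMomentum L k 0) - 2 * Real.cos (latticeMomentum L k 1) - μ)
    (fun k => Real.sqrt ((-2 * Real.cos (latticeMomentum L k 0) - 2 * Real.cos (latticeMomentum L k 1) - μ) ^ 2 +
      ‖((2 * Δ₁ * (Real.cos (latticeMomentum L k 0) - Real.cos (latticeMomentum L k 1)) : ℝ) : ℂ) -
        4 * Complex.I * ((Δ₂ * Real.sin (latticeMomentum L k 0) * Real.sin (latticeMomentum L k 1) : ℝ) : ℂ)‖ ^ 2))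
    (fun k => ((2 * Δ₁ * (Real.cos (latticeMomentum L k 0) - Real.cos (latticeMomentum L k 1)) : ℝ) : ℂ) -
      4 * Complex.I * ((Δ₂ * Real.sin (latticeMomentum L k 0) * Real.sin (latticeMomentum L k 1) : ℝ) : ℂ))
    (fun _ => rfl) (fun _ => rfl) (fun _ => rfl) (hL₀ L hLL)

end BirBdG

end Summit.HubbardSuperconductivity.HubbardSuperconductivity.Theorems

end
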